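import Mathlib
import HarnessLib
import Literature.Probability.Percolation.BlockResampling
import Literature.Probability.Percolation.InfiniteClusterDensity
import Literature.Probability.Percolation.PercolationEvents
import Literature.Probability.Percolation.PercolationProofs
import Literature.Probability.Percolation.BernoulliPercolation
import Literature.Probability.Percolation.CorrelationLengthDKTThm2

/-!
# Crux `PercTreeValue.TetrahedronHarrisGap` (stmt-CriticalPhenomena-7799), line `noise_bridges`
# (strategist s3) — stub `stub_noiseStability` (T)

Helper file for the crux skeleton `Cruxes/TetrahedronHarrisGap/Lines/noise_bridges.lean`,
`--supports stmt-CriticalPhenomena-7799`.  No new definitions; everything is stated in the tree's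
vocabulary (`bondPercolation`, `resample`, `IsPivotal`, `armEdges`).

**Statement** (stability of the co-pivotal count under noise).  `P = P_{p_c}` on `ℤ³`,
`P_s = bondPercolation (zdGraph 3) s`, `A = {0 ↔ (r,r,0)}`, `B = {(r,0,r) ↔ (0,r,r)}`,
`W = armEdges (2r) 0`, and for `x = (ω, (ω', M))` under `P ⊗ (P ⊗ P_s)` the noised configuration
`ω_s := resample (M ∩ W) (ω, ω')`.  With `g_e := {e ∈ Piv_A ∩ Piv_B}` (co-pivotality, NOT monotone):
`Σ_e P(g_e) − Σ_e (P⊗P⊗P_s){e ∈ Piv_A(ω), e ∈ Piv_B(ω_s)} ≤ s · Σ_{e,f ∈ W} P{f ∈ Piv(g_e)}`.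

**Proof** (union bound along the resampling path, for a GENERAL measurable event `E` on any
countable graph).
* *Termwise reduction.*  `P(g_e) = (P⊗P⊗P_s){ω ∈ g_e}` (first marginal), and
  `{ω ∈ g_e} ∖ {e ∈ Piv_A(ω) ∧ e ∈ Piv_B(ω_s)} ⊆ {ω ∈ g_e, ω_s ∉ g_e}`.
* *Hybrid chain by induction on the finite window* (`measureReal_mem_and_resample_mask_notMem_le`):
  adding one edge `f ∉ W` to the window, `{ω ∈ E, ω_{W ∪ f} ∉ E} ⊆ {ω ∈ E, ω_W ∉ E} ∪
  {ω_W ∈ E, ω_{W ∪ f} ∉ E}`, and the new piece forces `f ∈ M` (else nothing changed) and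
  `f ∈ Piv_E(ω_W)` (the two hybrids agree off `f` and exactly one lies in `E`:
  `isPivotal_of_agree_off`).
* *Each hybrid is a fair sample, and the mask bit is independent of it*: putting the mask `M`
  outermost (`measurePreserving_prodAssoc ∘ swap`), for every FIXED `M` the hybrid
  `resample (M ∩ W) (ω, ω')` has law `P` under `P ⊗ P` (`map_resample_prod`), so
  `(P⊗P⊗P_s){f ∈ M, ω_W ∈ Piv_E f} = ∫ 1{f ∈ M} · P{Piv_E f} dP_s(M) = s · P{Piv_E f}`
  (`bondPercolation_cylinder`).
* Sum over `e ∈ W`.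

References: O. Schramm, S. Smirnov, Ann. Probab. 39 (2011), §2 (hybrid chain "each `ω_j` is a fair
sample"); the tree's `BlockResampling.lean` (`setOf_mem_and_resample_notMem_subset`,
`mul_measureReal_lt_blockCondProb_lt_le_sum`) is the two-replica template; here the random mask is a
third product factor.
-/

noncomputable section

open MeasureTheory
open Literature.Probability.Percolation Literature.Probability.LatticeModels

namespace Summit.CriticalPhenomena.PercolationContinuityZ3.Theorems.TetrahedronHarrisGap

variable {V : Type*}

/-! ### Pivotality from a one-edge disagreement -/

/-- If two configurations agree off the coordinate `f` and exactly one of them lies in `E`, then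
`f` is pivotal for `E` in the first one (XOR-pivotality: `{insert f η, η ∖ f} = {insert f η', η' ∖ f}`
contains both `η` and `η'`). [folklore; Grimmett 1999 §2.4] -/
theorem isPivotal_of_agree_off {ι : Type*} {E : Set (Set ι)} {f : ι} {η η' : Set ι}
    (h : ∀ e, e ≠ f → (e ∈ η ↔ e ∈ η')) (hη : η ∈ E) (hη' : η' ∉ E) : IsPivotal E f η := by
  have hins : insert f η = insert f η' := by
    ext e
    by_cases hef : e = f
    · subst hef; simp
    · simp only [Set.mem_insert_iff, hef, false_or]; exact h e hef
  have hdiff : η \ {f} = η' \ {f} := by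
    ext e
    by_cases hef : e = f
    · subst hef; simp
    · simp only [Set.mem_sdiff, Set.mem_singleton_iff, hef, not_false_eq_true, and_true]
      exact h e hef
  have hne : η ≠ η' := fun heq => hη' (heq ▸ hη)
  by_cases hf : f ∈ η
  · by_cases hf' : f ∈ η'
    · exact absurd (by rw [← Set.insert_eq_of_mem hf, hins, Set.insert_eq_of_mem hf']) hne
    · refine Or.inl ⟨?_, ?_⟩
      · rw [Set.insert_eq_of_mem hf]; exact hη
      · rw [hdiff, Set.sdiff_singleton_eq_self hf']; exact hη'
  · by_cases hf' : f ∈ η'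
    · refine Or.inr ⟨?_, ?_⟩
      · rw [Set.sdiff_singleton_eq_self hf]; exact hη
      · rw [hins, Set.insert_eq_of_mem hf']; exact hη'
    · exact absurd (by rw [← Set.sdiff_singleton_eq_self hf, hdiff, Set.sdiff_singleton_eq_self hf'])
        hne

/-! ### One hybrid step -/

/-- **One hybrid step.**  Enlarging the resampled window by one edge `f`: if the hybrid over `U`
lies in `E` but the hybrid over `insert f U` does not, then the mask contains `f` (else nothing
changed) and `f` is pivotal for `E` in the hybrid over `U` (the two hybrids agree off `f`).
[cite: SchrammSmirnov2011, §2 (proof of Thm. 1.1: comparing ω_{j-1} to ω_j)] -/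
theorem setOf_resample_mask_step_subset (U : Set (Sym2 V)) (f : Sym2 V) (E : Set (BondConfig V)) :
    {x : BondConfig V × (BondConfig V × BondConfig V) |
        resample (x.2.2 ∩ U) (x.1, x.2.1) ∈ E ∧ resample (x.2.2 ∩ insert f U) (x.1, x.2.1) ∉ E} ⊆
      {x | f ∈ x.2.2 ∧ IsPivotal E f (resample (x.2.2 ∩ U) (x.1, x.2.1))} := by
  rintro x ⟨h1, h2⟩
  by_cases hfM : f ∈ x.2.2
  · refine ⟨hfM, isPivotal_of_agree_off (fun e hef => ?_) h1 h2⟩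
    refine mem_resample_iff_mem_resample ?_ _
    simp only [Set.mem_inter_iff, Set.mem_insert_iff, hef, false_or]
  · exfalso
    apply h2
    have heq : resample (x.2.2 ∩ insert f U) (x.1, x.2.1) = resample (x.2.2 ∩ U) (x.1, x.2.1) := by
      ext e
      refine mem_resample_iff_mem_resample ?_ _
      simp only [Set.mem_inter_iff, Set.mem_insert_iff]
      constructor
      · rintro ⟨hM, hf | hU⟩
        · exact absurd (hf ▸ hM) hfM
        · exact ⟨hM, hU⟩
      · rintro ⟨hM, hU⟩
        exact ⟨hM, Or.inr hU⟩
    rw [heq]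
    exact h1

/-! ### Each hybrid is a fair sample, and the mask bit is independent of it -/

/-- Putting the mask outermost: `(M, (ω, ω')) ↦ (ω, (ω', M))` transports `Q ⊗ (P ⊗ P)` to
`P ⊗ (P ⊗ Q)` (`prodAssoc ∘ swap`). [folklore] -/
theorem measurePreserving_toMaskOuter (P Q : Measure (BondConfig V)) [SFinite P] [SFinite Q] :
    MeasurePreserving
      (fun y : BondConfig V × (BondConfig V × BondConfig V) => (y.2.1, (y.2.2, y.1)))
      (Q.prod (P.prod P)) (P.prod (P.prod Q)) :=
  (measurePreserving_prodAssoc P P Q).comp (Measure.measurePreserving_swap)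

/-- **Fair sample with an independent mask bit.**  For a finite window `W`, an edge `f` and a
measurable `A`: `(P ⊗ P ⊗ P_s){f ∈ M, resample (M ∩ W) (ω, ω') ∈ A} = P_s{f ∈ M} · P(A)` — for every
fixed mask the hybrid has law `P` (`map_resample_prod`), then integrate the mask bit.
[cite: SchrammSmirnov2011, §2 (proof of Thm. 1.1: "each ω_j is a fair sample")] -/
theorem measureReal_mask_mem_and_resample_mem [Countable V] (G : SimpleGraph V)
    (p s : unitInterval) (W : Finset (Sym2 V)) (f : Sym2 V) {A : Set (BondConfig V)}
    (hA : MeasurableSet A) :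
    ((bondPercolation G p).prod ((bondPercolation G p).prod (bondPercolation G s))).real
        {x : BondConfig V × (BondConfig V × BondConfig V) |
          f ∈ x.2.2 ∧ resample (x.2.2 ∩ (↑W : Set (Sym2 V))) (x.1, x.2.1) ∈ A} =
      (bondPercolation G s).real {M | f ∈ M} * (bondPercolation G p).real A := by
  classical
  set P := bondPercolation G p with hP
  set Q := bondPercolation G s with hQ
  have m3 : Measurable fun x : BondConfig V × (BondConfig V × BondConfig V) => f ∈ x.2.2 :=
    (measurable_set_mem f).comp (measurable_snd.comp measurable_snd)
  -- the noised configuration `(ω, (ω', M)) ↦ resample (M ∩ W) (ω, ω')` is measurable: membership of an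
  -- edge is a Boolean combination of the three coordinates (as `measurable_resample`, and as
  -- `measurable_resample_inter` of the sibling file `…StubNoiseHarris.lean`)
  have hres : Measurable fun x : BondConfig V × (BondConfig V × BondConfig V) =>
      resample (x.2.2 ∩ (↑W : Set (Sym2 V))) (x.1, x.2.1) := by
    refine measurable_set_iff.2 fun e => ?_
    have h : (fun x : BondConfig V × (BondConfig V × BondConfig V) =>
        e ∈ resample (x.2.2 ∩ (↑W : Set (Sym2 V))) (x.1, x.2.1)) = fun x =>
        (e ∈ x.1 ∧ ¬(e ∈ x.2.2 ∧ e ∈ (↑W : Set (Sym2 V)))) ∨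
          (e ∈ x.2.1 ∧ (e ∈ x.2.2 ∧ e ∈ (↑W : Set (Sym2 V)))) := by
      funext x; exact propext mem_resample_iff
    rw [h]
    have m1 : Measurable fun x : BondConfig V × (BondConfig V × BondConfig V) => e ∈ x.1 :=
      (measurable_set_mem e).comp measurable_fst
    have m2 : Measurable fun x : BondConfig V × (BondConfig V × BondConfig V) => e ∈ x.2.1 :=
      (measurable_set_mem e).comp (measurable_fst.comp measurable_snd)
    have m3' : Measurable fun x : BondConfig V × (BondConfig V × BondConfig V) => e ∈ x.2.2 :=
      (measurable_set_mem e).comp (measurable_snd.comp measurable_snd)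
    exact (m1.and (m3'.and measurable_const).not).or (m2.and (m3'.and measurable_const))
  have hS : MeasurableSet {x : BondConfig V × (BondConfig V × BondConfig V) |
      f ∈ x.2.2 ∧ resample (x.2.2 ∩ (↑W : Set (Sym2 V))) (x.1, x.2.1) ∈ A} :=
    m3.setOf.inter (hres hA)
  have hmp := measurePreserving_toMaskOuter P Q
  have key : P.prod (P.prod Q) {x : BondConfig V × (BondConfig V × BondConfig V) |
      f ∈ x.2.2 ∧ resample (x.2.2 ∩ (↑W : Set (Sym2 V))) (x.1, x.2.1) ∈ A} =
        P A * Q {M | f ∈ M} := by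
    rw [← hmp.measure_preimage hS.nullMeasurableSet, Measure.prod_apply (hmp.measurable hS),
      ← lintegral_indicator_const (measurableSet_mem f)]
    refine lintegral_congr fun M => ?_
    show (P.prod P) {z : BondConfig V × BondConfig V |
        f ∈ M ∧ resample (M ∩ (↑W : Set (Sym2 V))) (z.1, z.2) ∈ A} =
      {M : BondConfig V | f ∈ M}.indicator (fun _ => P A) M
    have hMW : M ∩ (↑W : Set (Sym2 V)) = ↑(W.filter fun e => e ∈ M) := by
      ext e; simp [and_comm]
    by_cases hfM : f ∈ M
    · rw [Set.indicator_of_mem (show M ∈ {M' : BondConfig V | f ∈ M'} from hfM)]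
      have hset : {z : BondConfig V × BondConfig V |
          f ∈ M ∧ resample (M ∩ (↑W : Set (Sym2 V))) (z.1, z.2) ∈ A} =
            resample (↑(W.filter fun e => e ∈ M) : Set (Sym2 V)) ⁻¹' A := by
        ext z
        rw [Set.mem_preimage, ← hMW]
        exact ⟨fun h => h.2, fun h => ⟨hfM, h⟩⟩
      rw [hset, ← Measure.map_apply (measurable_resample _) hA, map_resample_prod]
    · rw [Set.indicator_of_notMem (show M ∉ {M' : BondConfig V | f ∈ M'} from hfM)]
      have hset : {z : BondConfig V × BondConfig V |
          f ∈ M ∧ resample (M ∩ (↑W : Set (Sym2 V))) (z.1, z.2) ∈ A} = ∅ := by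
        ext z
        simp only [Set.mem_setOf_eq, Set.mem_empty_iff_false, iff_false, not_and]
        exact fun h _ => hfM h
      rw [hset, measure_empty]
  rw [measureReal_def, key, ENNReal.toReal_mul, mul_comm]
  rfl

/-! ### The hybrid chain with a random mask: induction on the window -/

/-- **Stability under noise for a general event** (union bound along the resampling path).  For a
measurable event `E`, a finite window `W` of edges of `G` and a Bernoulli-`s` mask `M`:
`(P ⊗ P ⊗ P_s){ω ∈ E, resample (M ∩ W) (ω, ω') ∉ E} ≤ s · Σ_{f ∈ W} P{f ∈ Piv_E}`.  Induction on
`W`: one hybrid step (`setOf_resample_mask_step_subset`), the fair-sample identity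
(`measureReal_mask_mem_and_resample_mem`) and `P_s{f ∈ M} = s` (`bondPercolation_cylinder`).
[cite: SchrammSmirnov2011, §2 (proof of Thm. 1.1)] -/
theorem measureReal_mem_and_resample_mask_notMem_le [Countable V] (G : SimpleGraph V)
    (p s : unitInterval) (W : Finset (Sym2 V)) (hW : (↑W : Set (Sym2 V)) ⊆ G.edgeSet)
    {E : Set (BondConfig V)} (hE : MeasurableSet E) :
    ((bondPercolation G p).prod ((bondPercolation G p).prod (bondPercolation G s))).real
        {x : BondConfig V × (BondConfig V × BondConfig V) |
          x.1 ∈ E ∧ resample (x.2.2 ∩ (↑W : Set (Sym2 V))) (x.1, x.2.1) ∉ E} ≤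
      (s : ℝ) * ∑ f ∈ W, (bondPercolation G p).real {ω : BondConfig V | IsPivotal E f ω} := by
  classical
  induction W using Finset.induction_on with
  | empty =>
    have h0 : {x : BondConfig V × (BondConfig V × BondConfig V) |
        x.1 ∈ E ∧ resample (x.2.2 ∩ (↑(∅ : Finset (Sym2 V)) : Set (Sym2 V))) (x.1, x.2.1) ∉ E} = ∅ := by
      ext x
      simp [resample]
    rw [h0, measureReal_empty, Finset.sum_empty, mul_zero]
  | @insert f W hfW ih =>
    have hW' : (↑W : Set (Sym2 V)) ⊆ G.edgeSet := fun e he =>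
      hW (by rw [Finset.coe_insert]; exact Set.mem_insert_of_mem _ he)
    have hf : f ∈ G.edgeSet := hW (Finset.mem_coe.2 (Finset.mem_insert_self f W))
    have hsub : {x : BondConfig V × (BondConfig V × BondConfig V) |
        x.1 ∈ E ∧ resample (x.2.2 ∩ (↑(insert f W) : Set (Sym2 V))) (x.1, x.2.1) ∉ E} ⊆
        {x | x.1 ∈ E ∧ resample (x.2.2 ∩ (↑W : Set (Sym2 V))) (x.1, x.2.1) ∉ E} ∪
          {x | f ∈ x.2.2 ∧ IsPivotal E f (resample (x.2.2 ∩ (↑W : Set (Sym2 V))) (x.1, x.2.1))} := by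
      rintro x ⟨h1, h2⟩
      by_cases h : resample (x.2.2 ∩ (↑W : Set (Sym2 V))) (x.1, x.2.1) ∈ E
      · right
        refine setOf_resample_mask_step_subset (↑W : Set (Sym2 V)) f E ⟨h, ?_⟩
        rw [← Finset.coe_insert]
        exact h2
      · exact Or.inl ⟨h1, h⟩
    have h8 : ((bondPercolation G p).prod ((bondPercolation G p).prod (bondPercolation G s))).real
        {x : BondConfig V × (BondConfig V × BondConfig V) |
          f ∈ x.2.2 ∧ IsPivotal E f (resample (x.2.2 ∩ (↑W : Set (Sym2 V))) (x.1, x.2.1))} =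
        (s : ℝ) * (bondPercolation G p).real {ω : BondConfig V | IsPivotal E f ω} := by
      have := measureReal_mask_mem_and_resample_mem G p s W f
        (DKT20.measurableSet_isPivotal hE f)
      rw [bondPercolation_cylinder G s hf] at this
      exact this
    calc ((bondPercolation G p).prod ((bondPercolation G p).prod (bondPercolation G s))).real
          {x : BondConfig V × (BondConfig V × BondConfig V) |
            x.1 ∈ E ∧ resample (x.2.2 ∩ (↑(insert f W) : Set (Sym2 V))) (x.1, x.2.1) ∉ E}
        ≤ ((bondPercolation G p).prod ((bondPercolation G p).prod (bondPercolation G s))).real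
            ({x | x.1 ∈ E ∧ resample (x.2.2 ∩ (↑W : Set (Sym2 V))) (x.1, x.2.1) ∉ E} ∪
              {x | f ∈ x.2.2 ∧
                IsPivotal E f (resample (x.2.2 ∩ (↑W : Set (Sym2 V))) (x.1, x.2.1))}) :=
          measureReal_mono hsub
      _ ≤ ((bondPercolation G p).prod ((bondPercolation G p).prod (bondPercolation G s))).real
            {x | x.1 ∈ E ∧ resample (x.2.2 ∩ (↑W : Set (Sym2 V))) (x.1, x.2.1) ∉ E} +
          ((bondPercolation G p).prod ((bondPercolation G p).prod (bondPercolation G s))).real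
            {x | f ∈ x.2.2 ∧
              IsPivotal E f (resample (x.2.2 ∩ (↑W : Set (Sym2 V))) (x.1, x.2.1))} :=
          measureReal_union_le _ _
      _ ≤ (s : ℝ) * ∑ f ∈ W, (bondPercolation G p).real {ω : BondConfig V | IsPivotal E f ω} +
          (s : ℝ) * (bondPercolation G p).real {ω : BondConfig V | IsPivotal E f ω} :=
          add_le_add (ih hW') h8.le
      _ = (s : ℝ) * ∑ f ∈ insert f W, (bondPercolation G p).real {ω : BondConfig V | IsPivotal E f ω} := by
          rw [Finset.sum_insert hfW, mul_add, add_comm]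

/-! ### Termwise reduction and the stub -/

/-- The first marginal of the triple product: `(P ⊗ P ⊗ P_s){ω ∈ S} = P(S)`. [folklore] -/
theorem measureReal_setOf_fst_mem (P Q : Measure (BondConfig V)) [IsProbabilityMeasure P]
    [IsProbabilityMeasure Q] (S : Set (BondConfig V)) :
    (P.prod (P.prod Q)).real {x : BondConfig V × (BondConfig V × BondConfig V) | x.1 ∈ S} =
      P.real S := by
  have hS : {x : BondConfig V × (BondConfig V × BondConfig V) | x.1 ∈ S} = S ×ˢ Set.univ := by
    ext x; simp
  rw [hS, measureReal_prod_prod, probReal_univ, mul_one]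

/-- **Termwise stability of a co-pivotality indicator.**  For measurable events `A`, `B`, an edge
`e` and `g := {η | e ∈ Piv_A(η) ∧ e ∈ Piv_B(η)}`:
`P(g) − (P ⊗ P ⊗ P_s){e ∈ Piv_A(ω) ∧ e ∈ Piv_B(ω_s)} ≤ (P⊗P⊗P_s){ω ∈ g, ω_s ∉ g} ≤ s · Σ_{f∈W} P{f ∈ Piv_g}`
(`ω_s = resample (M ∩ W) (ω, ω')`). [cite: SchrammSmirnov2011, §2 (proof of Thm. 1.1)] -/
theorem measureReal_coPivotal_sub_le [Countable V] (G : SimpleGraph V) (p s : unitInterval)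
    (W : Finset (Sym2 V)) (hW : (↑W : Set (Sym2 V)) ⊆ G.edgeSet) {A B : Set (BondConfig V)}
    (hA : MeasurableSet A) (hB : MeasurableSet B) (e : Sym2 V) :
    (bondPercolation G p).real {ω : BondConfig V | IsPivotal A e ω ∧ IsPivotal B e ω} -
        ((bondPercolation G p).prod ((bondPercolation G p).prod (bondPercolation G s))).real
          {x : BondConfig V × (BondConfig V × BondConfig V) | IsPivotal A e x.1 ∧
            IsPivotal B e (resample (x.2.2 ∩ (↑W : Set (Sym2 V))) (x.1, x.2.1))} ≤
      (s : ℝ) * ∑ f ∈ W, (bondPercolation G p).real {ω : BondConfig V |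
        IsPivotal {η : BondConfig V | IsPivotal A e η ∧ IsPivotal B e η} f ω} := by
  set g : Set (BondConfig V) := {η : BondConfig V | IsPivotal A e η ∧ IsPivotal B e η} with hg
  have hgm : MeasurableSet g :=
    (DKT20.measurableSet_isPivotal hA e).inter (DKT20.measurableSet_isPivotal hB e)
  rw [← measureReal_setOf_fst_mem (bondPercolation G p) (bondPercolation G s) g]
  refine (le_measureReal_sdiff).trans ?_
  refine le_trans (measureReal_mono ?_) (measureReal_mem_and_resample_mask_notMem_le G p s W hW hgm)
  rintro x ⟨hx1, hx2⟩
  exact ⟨hx1, fun h => hx2 ⟨hx1.1, h.2⟩⟩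

/-- **stub_noiseStability (T)** (registered stub of line `noise_bridges`): stability of the
co-pivotal count under noise, `J − C(s) ≤ s · F` — union bound along the resampling path
(`measureReal_coPivotal_sub_le` summed over the window `W = armEdges (2r) 0`, whose members are
lattice edges, `armEdges_subset_edgeSet`). [cite: SchrammSmirnov2011, §2; folklore] -/
theorem stub_noiseStability :
    ∀ (r : ℕ) (s : unitInterval),
      (∑ e ∈ armEdges (2 * r) (0 : Site 3), (bondPercolation (zdGraph 3) (criticalProbI 3)).real {ω : BondConfig (Site 3) | IsPivotal (openConn (0 : Site 3) ![(r : ℤ), (r : ℤ), 0]) e ω ∧ IsPivotal (openConn ![(r : ℤ), 0, (r : ℤ)] ![0, (r : ℤ), (r : ℤ)]) e ω}) -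
        (∑ e ∈ armEdges (2 * r) (0 : Site 3), ((bondPercolation (zdGraph 3) (criticalProbI 3)).prod ((bondPercolation (zdGraph 3) (criticalProbI 3)).prod (bondPercolation (zdGraph 3) s))).real {x : BondConfig (Site 3) × (BondConfig (Site 3) × BondConfig (Site 3)) | IsPivotal (openConn (0 : Site 3) ![(r : ℤ), (r : ℤ), 0]) e x.1 ∧ IsPivotal (openConn ![(r : ℤ), 0, (r : ℤ)] ![0, (r : ℤ), (r : ℤ)]) e (resample (x.2.2 ∩ (↑(armEdges (2 * r) (0 : Site 3)) : Set (Sym2 (Site 3)))) (x.1, x.2.1))}) ≤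
      (s : ℝ) * (∑ e ∈ armEdges (2 * r) (0 : Site 3), ∑ f ∈ armEdges (2 * r) (0 : Site 3), (bondPercolation (zdGraph 3) (criticalProbI 3)).real {ω : BondConfig (Site 3) | IsPivotal {η : BondConfig (Site 3) | IsPivotal (openConn (0 : Site 3) ![(r : ℤ), (r : ℤ), 0]) e η ∧ IsPivotal (openConn ![(r : ℤ), 0, (r : ℤ)] ![0, (r : ℤ), (r : ℤ)]) e η} f ω}) := by
  intro r s
  rw [← Finset.sum_sub_distrib, Finset.mul_sum]
  refine Finset.sum_le_sum fun e _ => ?_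
  exact measureReal_coPivotal_sub_le (zdGraph 3) (criticalProbI 3) s (armEdges (2 * r) (0 : Site 3))
    (armEdges_subset_edgeSet (2 * r) (0 : Site 3)) (measurableSet_openConn_holds _ _)
    (measurableSet_openConn_holds _ _) e

end Summit.CriticalPhenomena.PercolationContinuityZ3.Theorems.TetrahedronHarrisGap

end
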